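import Mathlib
import Summits.Ventures.PercRepro2.HCov
import Summits.Ventures.PercRepro2.CycleNecklaceConn
import Summits.Ventures.PercRepro2.CycleNecklace
import Summits.Ventures.PercRepro2.GcSkelRules
import Summits.Ventures.PercRepro2.GcSkelReduction
import Summits.Ventures.PercRepro2.GcSkelReductionS
import Summits.Ventures.PercRepro2.GcSkelReductionC
import Summits.Ventures.PercRepro2.HubClassesAll
import Summits.Ventures.PercRepro2.GcSkelReductionR

/-!
# The residual minus the necklaces (blind cell PercRepro2, typer-1 g52)

The necklace theorem `Cycle.HCov_necklace` (typer-1 g48; S3.7 (C7), every cycle is a necklace with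
the arcs as blocks) is stated on a general graph through the predicate `Cycle.IsNecklace ends q blk
Vj` — the edges fall into five blocks living on vertex sets `Vj j` that meet only in the terminals
`q j`, `q (j + 1)`, the five marks in cyclic order. So it removes one more class from the weighted
residual: **`WReducedN`** := `WReducedR` ∧ the marks `o, a₁, a₂, a₃, b` are not the five terminals
of a necklace. **`HCov_all_iff_HCovWRedN_all`**.
-/

namespace Summit.Ventures.PercRepro2

open CovForm

namespace WRed

section ClassN

variable {V : Type*} {E : Type*} [Fintype E] [DecidableEq E] [DecidableEq V]

/-- **The residual minus the necklaces**: `WReducedR`, and the five marks are not the terminals of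
a necklace (`Cycle.IsNecklace`) in any cyclic order. -/
structure WReducedN (ends : E → Sym2 V) (o a₁ a₂ a₃ b : V) : Prop
    extends WReducedR ends o a₁ a₂ a₃ b where
  /-- the marks are not the terminals of a necklace -/
  noNecklace : ∀ (q : Fin 5 → V) (blk : E → Fin 5) (Vj : Fin 5 → Set V),
    Cycle.IsNecklace ends q blk Vj → ∀ ko k₁ k₂ k₃ kb : Fin 5, ko ≠ k₁ → ko ≠ k₂ → ko ≠ k₃ →
    ko ≠ kb → k₁ ≠ k₂ → k₁ ≠ k₃ → k₁ ≠ kb → k₂ ≠ k₃ → k₂ ≠ kb → k₃ ≠ kb →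
    q ko = o → q k₁ = a₁ → q k₂ = a₂ → q k₃ = a₃ → q kb ≠ b

end ClassN

section Closure

variable (R : Type*) [Field R] [LinearOrder R] [IsStrictOrderedRing R]

/-- **(HCOV) on the residual minus the necklaces**. -/
def HCovWRedN_all : Prop :=
  ∀ (V E : Type) [Fintype V] [DecidableEq V] [Fintype E] [DecidableEq E]
    (ends : E → Sym2 V) (p : E → R), IsProbVec p →
    ∀ o a₁ a₂ a₃ b : V, a₁ ≠ a₂ → a₁ ≠ a₃ → a₂ ≠ a₃ → o ≠ a₁ → o ≠ a₂ → o ≠ a₃ → o ≠ b →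
      b ≠ a₁ → b ≠ a₂ → b ≠ a₃ → WReducedN ends o a₁ a₂ a₃ b → HCov p ends o a₁ a₂ a₃ b

end Closure

section Main

variable {R : Type*} [Field R] [LinearOrder R] [IsStrictOrderedRing R]

/-- (HCOV) on the residual follows from (HCOV) on the residual minus the necklaces: a necklace is
a theorem. -/
theorem HCovWRedR_all_of_HCovWRedN_all (hB : HCovWRedN_all R) : HCovWRedR_all R := by
  intro V E _ _ _ _ ends p hp o a₁ a₂ a₃ b h12 h13 h23 ho1 ho2 ho3 hob hb1 hb2 hb3 hred
  by_cases hN : ∃ (q : Fin 5 → V) (blk : E → Fin 5) (Vj : Fin 5 → Set V),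
      Cycle.IsNecklace ends q blk Vj ∧ ∃ ko k₁ k₂ k₃ kb : Fin 5, ko ≠ k₁ ∧ ko ≠ k₂ ∧ ko ≠ k₃ ∧
      ko ≠ kb ∧ k₁ ≠ k₂ ∧ k₁ ≠ k₃ ∧ k₁ ≠ kb ∧ k₂ ≠ k₃ ∧ k₂ ≠ kb ∧ k₃ ≠ kb ∧
      q ko = o ∧ q k₁ = a₁ ∧ q k₂ = a₂ ∧ q k₃ = a₃ ∧ q kb = b
  · obtain ⟨q, blk, Vj, hNk, ko, k₁, k₂, k₃, kb, h01, h02, h03, h04, h12', h13', h14, h23', h24,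
      h34, rfl, rfl, rfl, rfl, rfl⟩ := hN
    exact Cycle.HCov_necklace hNk p hp ko k₁ k₂ k₃ kb h01 h02 h03 h04 h12' h13' h14 h23' h24 h34
  push Not at hN
  exact hB V E ends p hp o a₁ a₂ a₃ b h12 h13 h23 ho1 ho2 ho3 hob hb1 hb2 hb3 ⟨hred, hN⟩

/-- **THE WEIGHTED RESIDUAL MINUS THE NECKLACES**: (HCOV) for every finite weighted graph with
five distinct marks follows from (HCOV) on `WReducedN`. -/
theorem HCov_all_of_HCovWRedN_all (hB : HCovWRedN_all R) : HCov_all R :=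
  HCov_all_of_HCovWRedR_all (HCovWRedR_all_of_HCovWRedN_all hB)

/-- The residual minus the necklaces is a faithful reduction: `HCov_all ↔ HCovWRedN_all`. -/
theorem HCov_all_iff_HCovWRedN_all : HCov_all R ↔ HCovWRedN_all R :=
  ⟨fun h V E _ _ _ _ ends p hp o a₁ a₂ a₃ b h12 h13 h23 ho1 ho2 ho3 hob hb1 hb2 hb3 _ =>
    h V E ends p hp o a₁ a₂ a₃ b h12 h13 h23 ho1 ho2 ho3 hob hb1 hb2 hb3,
   HCov_all_of_HCovWRedN_all⟩

end Main

end WRed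

end Summit.Ventures.PercRepro2
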